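import Literature.AlgebraicGeometry.Resolution.WeightedCentreZKernelFlow
import HarnessLib

/-!
# Weighted centres — the eigen-flow climb of THEOREM A⁺ (T103 core): `X′ ≡ Φ_𝔇(σ^r) (mod σ^{p+1})`

Instrument for engine 1's `W(f)` TOY MODEL (cell `pub-rosobs`, LF-MODEL-eng1-g45 §6.2), NOT a resolution theorem and NOT about the invariant of
[AbramovichTemkinWlodarczyk2024].  THEOREM A⁺ (bottom-class rigidity) argues, in its case `2 ≤ r ≤ p − 1`: after the eigen-lift L2
(`EigenLift.eigen_lift_orbit`) one has a graded `k[σ]`-automorphism `X′ ∈ 𝔄_r` of `k[ε][σ]`, fixing the slots of weight `> p + 1`, with an eigen-relation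
`s_{μ₀} X′ = X′^{n₀} · h`, `n₀ ≡ μ₀^r`, `h ∈ 𝔄_{p+1}` (`μ₀` a generator of `𝔽_pˣ`); reading `𝔇 := π_r(X′)` as a derivation (`ZKernel.projDer`, triangular of degree `−r`),
the flow `Φ := Φ_𝔇(σ^r)` (`TruncatedFlow.flowEquiv`, the weight-bounded flow W3: every unfixed slot weighs `≤ p + 1 < p·r`) is an EXACT eigen-element of `𝔄_r` with
`π_r(Φ) = π_r(X′)`, and the eigen-CLIMB L8 (`EigenLift.eigen_climb`, levels `r + 1 ≤ m ≤ p` non-resonant, terminal level `p + 1 ∋ h`) gives `Φ⁻¹ X′ ∈ 𝔄_{p+1}`: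
THIS FILE, `BottomClimb.X_pow_dvd_sub_flow` — `σ^{p+1} ∣ X′ y − Φ_𝔇(σ^r) y` for every `y`.  (The remaining steps of A⁺ — `E := Φ⁻¹X′` is a pure `f`-translation, `X′ = Φ ∘ E` is a
graded `k[τ]`-substitution with `τ = σ^r` free, and L7 `KillCoordinates` at the bottom class — are NOT typed here.)

References: automorphisms of polynomial rings and their congruence filtration [Lang2002, Ch. I §3, Ch. IV §1, Ch. V §5]; derivations and truncated exponential flows
[Matsumura1987, §25, §27]; the torus `σ ↦ μσ` [SerreLocalFields1979, Ch. II §4 Lemma 1]; weighted homogeneity as in [AbramovichTemkinWlodarczyk2024, §5.1, Thm. 5.3.1 (2)–(3)]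
(dictionary only).
-/

namespace Literature.AlgebraicGeometry.Resolution.WeightedBlowup.BottomClimb

open Polynomial OrderFiltration LevelProjection EigenLiftLevels EigenLift TruncatedFlow ZKernel

variable {k : Type*} [CommRing k] {ι : Type*}

variable {w : ι → ℚ} {p : ℕ} [Fact p.Prime] [CharP k p] {u : ℕ → k}

omit [Fact p.Prime] [CharP k p] in
/-- The W3 weight regime of `𝔇 = π_r(X′)`, `r ≥ 2`: every slot weighs `< p·r` or is killed by `𝔇` (slots of weight `> p + 1` are fixed; bookkeeping).
[cite: AbramovichTemkinWlodarczyk2024, §5.1 (p. 1575)] -/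
theorem weight_lt_or_projDer_eq_zero {x : (MvPolynomial ι k)[X] ≃+* (MvPolynomial ι k)[X]}
    (hxV : ∀ i, (p : ℚ) + 1 < w i → x (C (MvPolynomial.X i)) = C (MvPolynomial.X i)) {r : ℕ} (hr2 : 2 ≤ r) (hp2 : 2 ≤ p) (i : ι) :
    w i < p • (r : ℚ) ∨ projDer r x (MvPolynomial.X i) = 0 := by
  rcases le_or_gt (w i) ((p : ℚ) + 1) with hi | hi
  · left
    rw [nsmul_eq_mul]
    have h2r : (2 : ℚ) ≤ r := by exact_mod_cast hr2
    have h2p : (2 : ℚ) ≤ p := by exact_mod_cast hp2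
    nlinarith
  · exact Or.inr (projDer_X_of_V hxV r i hi)

/-- **THE EIGEN-FLOW CLIMB OF THEOREM A⁺** (LF-MODEL-eng1-g45 §6.2, case `2 ≤ r ≤ p − 1`, steps L3 + L8; T103 core): in the setting — `char k = p`, `u_n n! = 1` (`n < p`), non-negative slot
weights, the slots of weight `> p + 1` fixed — let `x` be a graded `k[σ]`-automorphism of `k[ε][σ]` in `𝔄_r`, `2 ≤ r ≤ p − 1`, with the eigen-relation `s_{μ₀} x = x^{n₀} · h` for a generator `μ₀` of
`𝔽_pˣ`, `n₀ ≡ μ₀^r (mod p)` and an `h ∈ 𝔄_{p+1}` that is graded, base-fixing and fixes the slots of weight `> p + 1` (the output of the eigen-lift L2).  Then `x ≡ Φ_𝔇(σ^r) (mod σ^{p+1})`,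
`𝔇 := π_r(x)`: `σ^{p+1} ∣ x y − Φ_𝔇(σ^r) y` for every `y` — `π_r(Φ_𝔇(σ^r)) = 𝔇` (`ZKernel.proj_flowEquiv`), `Φ_𝔇(σ^r)` is an exact eigen-element (`ZKernel.scaleConj_castUnit_flowEquiv`), and the
climb `EigenLift.eigen_climb` in `K = graded ⊓ baseFixing ⊓ 𝔄_1 ⊓ fixSlots V` (levels `r + 1 ≤ m ≤ p` non-resonant, `EigenLift.nonresonant_of_orderOf`) ends at level `p + 1 ∋ h`.  Instrument for engine 1's
`W(f)` toy model, NOT a resolution theorem. [cite: Lang2002, Ch. I §§3, 6, Ch. IV §1, Ch. V §5; Matsumura1987, §27 (pp. 207–209); SerreLocalFields1979, Ch. II §4 Lemma 1; AbramovichTemkinWlodarczyk2024, §5.1 (p. 1575), Thm. 5.3.1 (2)–(3) (p. 1578)] -/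
theorem X_pow_dvd_sub_flow (hu : ∀ n < p, (Nat.factorial n : k) * u n = 1) (hw : ∀ i, 0 ≤ w i)
    {x : (MvPolynomial ι k)[X] ≃+* (MvPolynomial ι k)[X]} (hxg : x ∈ graded w (1 : ℚ)) (hxb : x ∈ baseFixing)
    (hxV : ∀ i, (p : ℚ) + 1 < w i → x (C (MvPolynomial.X i)) = C (MvPolynomial.X i)) {r : ℕ} (hr2 : 2 ≤ r) (hrp : r ≤ p - 1)
    (hl : x ∈ level (X : (MvPolynomial ι k)[X]) r) {μ₀ : (ZMod p)ˣ} (hμ₀ : orderOf μ₀ = p - 1) {n₀ : ℕ} (hn₀ : (n₀ : ZMod p) = (μ₀ : ZMod p) ^ r)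
    {h : (MvPolynomial ι k)[X] ≃+* (MvPolynomial ι k)[X]} (hhg : h ∈ graded w (1 : ℚ)) (hhb : h ∈ baseFixing)
    (hhV : ∀ i, (p : ℚ) + 1 < w i → h (C (MvPolynomial.X i)) = C (MvPolynomial.X i)) (hhl : h ∈ level (X : (MvPolynomial ι k)[X]) (p + 1))
    (hsx : scaleConj (castUnit p μ₀) x = x ^ n₀ * h) (y : (MvPolynomial ι k)[X]) :
    X ^ (p + 1) ∣ x y - flow (projDer r x) p u (C 1 * X ^ r) y := by
  have hp2 : 2 ≤ p := (Fact.out : p.Prime).two_le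
  have hp1 : 1 ≤ p := by omega
  have hr1 : 1 ≤ r := by omega
  have hrp' : r < p := by omega
  have hxg1 : IsGradedHom w (1 : ℚ) (x : (MvPolynomial ι k)[X] →+* (MvPolynomial ι k)[X]) := hxg.1
  -- `𝔇 := π_r(x)` read as a derivation, and its shape
  set D := projDer r x with hDdef
  have hDX : ∀ i, MvPolynomial.IsWeightedHomogeneous w (D (MvPolynomial.X i)) (w i - r) := fun i =>
    isWeightedHomogeneous_projDer hxg1 r i
  have hD : ∀ (a : MvPolynomial ι k) (m : ℚ), MvPolynomial.IsWeightedHomogeneous w a m →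
      MvPolynomial.IsWeightedHomogeneous w (D a) (m - r) := fun a m ha => TailedLightFlow.lowers_of_X D hDX ha
  have hθ : (0 : ℚ) ≤ r := Nat.cast_nonneg r
  have hgen : ∀ i, w i < p • (r : ℚ) ∨ D (MvPolynomial.X i) = 0 := fun i => weight_lt_or_projDer_eq_zero hxV hr2 hp2 i
  -- `Φ := Φ_𝔇(σ^r)` and the ambient `Q`-stable group `K`
  set Φ := flowEquiv D p u hu hp1 hw hθ hD hgen (C 1 * X ^ r) with hΦdef
  set V : Set ι := {i | (p : ℚ) + 1 < w i} with hVdef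
  set K : Subgroup ((MvPolynomial ι k)[X] ≃+* (MvPolynomial ι k)[X]) :=
    graded w (1 : ℚ) ⊓ baseFixing ⊓ level (X : (MvPolynomial ι k)[X]) 1 ⊓ fixSlots V with hKdef
  have hQ : ∀ μ : (ZMod p)ˣ, ∀ A ∈ K, scaleConj (castUnit p μ) A ∈ K := fun μ A hA =>
    ⟨⟨⟨scaleConj_mem_graded _ hA.1.1.2 hA.1.1.1, scaleConj_mem_baseFixing _ hA.1.1.2⟩, scaleConj_mem_level _ hA.1.1.2 hA.1.2⟩,
      scaleConj_mem_fixSlots _ hA.2⟩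
  have hK1 : K ≤ level (X : (MvPolynomial ι k)[X]) 1 := fun A hA => hA.1.2
  have hKb : K ≤ baseFixing := fun A hA => hA.1.1.2
  -- memberships of `Φ`, `x`, `h`
  have hΦb : Φ ∈ baseFixing := flowEquiv_mem_baseFixing hu hp1 hw hθ hD hgen _
  have hΦr : Φ ∈ level (X : (MvPolynomial ι k)[X]) r := flowEquiv_mem_level hu hp1 hw hθ hD hgen hrp'.le (dvd_mul_left _ _)
  have hΦ1 : Φ ∈ level (X : (MvPolynomial ι k)[X]) 1 := level_antitone _ hr1 hΦr
  have hΦg : Φ ∈ graded w (1 : ℚ) := flowEquiv_mem_graded hu hp1 hw hθ hD hgen hr1 1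
  have hΦV : Φ ∈ fixSlots V := flowEquiv_mem_fixSlots hu hp1 hw hθ hD hgen (fun v hv => projDer_X_of_V hxV r v hv) _
  have hΦK : Φ ∈ K := ⟨⟨⟨hΦg, hΦb⟩, hΦ1⟩, hΦV⟩
  have hx1 : x ∈ level (X : (MvPolynomial ι k)[X]) 1 := level_antitone _ hr1 hl
  have hxK : x ∈ K := ⟨⟨⟨hxg, hxb⟩, hx1⟩, mem_fixSlots.mpr fun i hi => hxV i hi⟩
  have hh1 : h ∈ level (X : (MvPolynomial ι k)[X]) 1 := level_antitone _ (by omega : 1 ≤ p + 1) hhl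
  have hhK : h ∈ K := ⟨⟨⟨hhg, hhb⟩, hh1⟩, mem_fixSlots.mpr fun i hi => hhV i hi⟩
  -- the eigen-climb in `K`, terminal level `p + 1`
  have hres : ∀ m, r + 1 ≤ m → m < p + 1 → μ₀ ^ m ≠ μ₀ ^ r := fun m hm1 hm2 =>
    nonresonant_of_orderOf hμ₀ (by omega) (by omega)
  have hΦir : Φ⁻¹ ∈ level (X : (MvPolynomial ι k)[X]) r := (level _ r).inv_mem hΦr
  have hE : (⟨Φ, hΦK⟩ : K)⁻¹ * ⟨x, hxK⟩ ∈ levelIn (X : (MvPolynomial ι k)[X]) K (r + 1) := by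
    show Φ⁻¹ * x ∈ level (X : (MvPolynomial ι k)[X]) (r + 1)
    refine mem_level_succ_of_proj_eq_zero (mul_mem hΦir hl) (mul_mem (baseFixing.inv_mem hΦb) hxb) fun i => ?_
    rw [proj_mul hr1 hΦir hl, proj_inv hr1 hΦr, proj_flowEquiv hu hp1 hw hθ hD hgen hr1 hrp' 1 i, one_smul, hDdef, projDer_X,
      neg_add_cancel]
  have hh : (⟨h, hhK⟩ : K) ∈ levelIn (X : (MvPolynomial ι k)[X]) K (p + 1) := mem_levelIn.mpr hhl
  have hΦ : sConj K hQ μ₀ ⟨Φ, hΦK⟩ = ⟨Φ, hΦK⟩ ^ n₀ := Subtype.ext (by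
    rw [coe_sConj, Subgroup.coe_pow]
    exact scaleConj_castUnit_flowEquiv hu hp1 hw hθ hD hgen hn₀)
  have hx : sConj K hQ μ₀ ⟨x, hxK⟩ = ⟨x, hxK⟩ ^ n₀ * ⟨h, hhK⟩ := Subtype.ext (by
    rw [coe_sConj, Subgroup.coe_mul, Subgroup.coe_pow]
    exact hsx)
  have hclimb := eigen_climb hK1 hKb hQ μ₀ n₀ hn₀ (by omega : r + 1 ≤ p + 1) hres hE hh hΦ hx
  -- `x ≡ Φ (mod σ^{p+1})`
  obtain ⟨z, hz⟩ := (mem_levelIn.mp hclimb).2 y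
  have hz' : Φ.symm (x y) = y + X ^ (p + 1) * z := hz
  have e : x y = Φ (y + X ^ (p + 1) * z) := by rw [← hz', RingEquiv.apply_symm_apply]
  rw [map_add, map_mul, map_pow, hΦb.1] at e
  refine ⟨Φ z, ?_⟩
  rw [e, hΦdef, flowEquiv_apply, flowEquiv_apply]
  ring

end Literature.AlgebraicGeometry.Resolution.WeightedBlowup.BottomClimb
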